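import Summits.ValiantsHypothesis.ValiantsHypothesis.Theses.ProjectionStability
import Summits.ValiantsHypothesis.ValiantsHypothesis.Theses.ProjectionRigidity
import Literature.Computability.AlgebraicComplexity.DeterminantalConormalBoundKernelAlgebra
import Summits.ValiantsHypothesis.ValiantsHypothesis.Theorems.ProjectionStabilityPdcQpOfVpStubIsQPBoundedMul
import Literature.Computability.AlgebraicComplexity.VPDeterminantalQPProofs
import Literature.Computability.AlgebraicComplexity.ValiantClassesProofs

/-!
# `PdcQpOfVp` (stmt-ValiantsHypothesis-16003) — the bridge: `per ∈ VP ⇒ n ↦ pdc(per_n)` is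
quasi-polynomially bounded

Routes `ProjectionStability` and `ProjectionRigidity` of `ValiantsHypothesis` share this crux (same
statement, two route copies, equal by `rfl`):

  `IsVPFamily (n ↦ per_n) → IsQPBounded (n ↦ pdc(per_n))`,  `pdc = detProjectionComplexity`
  (Valiant's measure: the least `m` with `per_n` a projection of `DET_m`, every cell a variable or
  a constant).

LINE `birth` (Schur-complement expansion; Bürgisser–Clausen–Shokrollahi 1997 §21.5 / Cor. (21.40),
Bürgisser 2000 Prop. 2.30 and §2.5, Bürgisser 2024 arXiv:2406.06217 Prop. 2.23). The tree PROVES the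
affine bound `IsVPFamily f → IsQPBounded (n ↦ dc(f_n))`
(`isQPBounded_determinantalComplexity_of_isVPFamily_holds`); the passage from affine determinantal
representations to Valiant projections costs a polynomial factor only:

* `stub_isDetProjection_of_hasDetRepr` (below) — an affine determinantal representation of size
  `m` in `N = #σ` variables expands to a PROJECTION of `DET_{(N+1)·m}`: write `A = D + Σ_v X_v A_v`
  (`D, A_v` constant; `DeterminantalConormal.eq_C_add_sum_of_totalDegree_le_one`) and take the block
  matrix `[[1, B], [C, D]]` on `(σ × Fin m) ⊕ Fin m` with `B ((v, j'), j) = [j' = j] X_v` and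
  `C (i, (v, j')) = -(A_v) i j'` (constants); `Matrix.det_fromBlocks_one₁₁` gives
  `det = det (D - C B) = det A`, and every entry is a variable or a constant.
* `stub_isQPBounded_mul` (file `ProjectionStabilityPdcQpOfVpStubIsQPBoundedMul`) —
  quasi-polynomially bounded functions are closed under pointwise products.

COMPOSITION: `dc(per_n)` is qp-bounded (tree), `n² + 1` is p-bounded hence qp-bounded
(`IsPBounded.isQPBounded`), so `(n²+1)·dc(per_n)` is qp-bounded (stub 2); `dc` is attained
(`hasDetRepr_determinantalComplexity_holds`), so stub 1 gives
`IsDetProjection per_n ((n²+1)·dc(per_n))`, whence `pdc(per_n) ≤ (n²+1)·dc(per_n)` (`Nat.sInf_le`).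

References: L. G. Valiant, *Completeness classes in algebra*, STOC 1979, Thm. 1; P. Bürgisser,
*Completeness and Reduction in Algebraic Complexity Theory* (2000), Prop. 2.30, §2.5;
P. Bürgisser, M. Clausen, M. A. Shokrollahi, *Algebraic Complexity Theory* (1997), Cor. (21.40);
P. Bürgisser, arXiv:2406.06217 (2024), Prop. 2.23.
-/

-- D-0017 layout: Sub = Summit for this single-conjunct summit, so the namespace repeats a component.
set_option linter.dupNamespace false

namespace Summit.ValiantsHypothesis.ValiantsHypothesis.Theorems.ProjectionStabilityPdcQpOfVp

open MvPolynomial Literature.Computability.AlgebraicComplexity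

/-- **Affine → projection at polynomial cost** (Bürgisser 2000, §2.5; Bürgisser 2024,
arXiv:2406.06217, Prop. 2.23; the Schur-complement expansion): if `f = det A` for an `m × m`
matrix `A` of affine linear forms in the variables `σ`, then `f` is a projection of the generic
determinant `DET_{(#σ+1)·m}`. Write `A = D + Σ_v X_v · A_v` with `D, A_v` constant matrices
(`DeterminantalConormal.eq_C_add_sum_of_totalDegree_le_one`) and form the block matrix
`M = [[1, B], [C, D]]` on `(σ × Fin m) ⊕ Fin m` with `B ((v, j'), j) = [j' = j] · X_v` and
`C (i, (v, j')) = -(A_v) i j'`; every entry of `M` is a variable or a constant, and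
`det M = det (D - C · B) = det A` (`Matrix.det_fromBlocks_one₁₁`). -/
theorem stub_isDetProjection_of_hasDetRepr :
    ∀ {k : Type} [CommRing k] {σ : Type} [Fintype σ] (f : MvPolynomial σ k) (m : ℕ),
      HasDetRepr f m → IsDetProjection f ((Fintype.card σ + 1) * m) := by
  intro k _ σ _ f m h
  classical
  obtain ⟨A, hA, rfl⟩ := h
  -- linear coefficients `c v i j = coeff_{X_v} (A i j)` and the four blocks
  let c : σ → Fin m → Fin m → k := fun v i j => coeff (Finsupp.single v 1) (A i j)
  let B : Matrix (σ × Fin m) (Fin m) (MvPolynomial σ k) :=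
    Matrix.of fun p j => if p.2 = j then X p.1 else 0
  let Cb : Matrix (Fin m) (σ × Fin m) (MvPolynomial σ k) :=
    Matrix.of fun i p => C (-c p.1 i p.2)
  let D : Matrix (Fin m) (Fin m) (MvPolynomial σ k) :=
    Matrix.of fun i j => C (coeff 0 (A i j))
  let M : Matrix ((σ × Fin m) ⊕ Fin m) ((σ × Fin m) ⊕ Fin m) (MvPolynomial σ k) :=
    Matrix.fromBlocks 1 B Cb D
  -- the Schur complement of the identity block is `A` itself
  have hDCB : D - Cb * B = A := by
    ext i j
    rw [Matrix.sub_apply, Matrix.mul_apply, Fintype.sum_prod_type]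
    simp only [B, Cb, D, Matrix.of_apply, mul_ite, mul_zero, Finset.sum_ite_eq',
      Finset.mem_univ, if_true]
    conv_rhs => rw [DeterminantalConormal.eq_C_add_sum_of_totalDegree_le_one (hA i j)]
    simp only [c, C_neg, neg_mul, Finset.sum_neg_distrib, sub_neg_eq_add]
  have hM : M.det = A.det := by
    simp only [M]
    rw [Matrix.det_fromBlocks_one₁₁, hDCB]
  -- every entry of `M` is a variable or a constant
  have hent : ∀ p q, (∃ v, M p q = X v) ∨ ∃ a, M p q = C a := by
    rintro (p | i) (q | j)
    · refine Or.inr ⟨if p = q then 1 else 0, ?_⟩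
      simp only [M, Matrix.fromBlocks_apply₁₁, Matrix.one_apply]
      split_ifs <;> simp
    · simp only [M, Matrix.fromBlocks_apply₁₂, B, Matrix.of_apply]
      split_ifs
      · exact Or.inl ⟨p.1, rfl⟩
      · exact Or.inr ⟨0, C_0.symm⟩
    · simp only [M, Matrix.fromBlocks_apply₂₁, Cb, Matrix.of_apply]
      exact Or.inr ⟨_, rfl⟩
    · simp only [M, Matrix.fromBlocks_apply₂₂, D, Matrix.of_apply]
      exact Or.inr ⟨_, rfl⟩
  -- reindex along `(σ × Fin m) ⊕ Fin m ≃ Fin ((#σ + 1) · m)` and read off the projection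
  have hcard : Fintype.card ((σ × Fin m) ⊕ Fin m) = (Fintype.card σ + 1) * m := by
    simp only [Fintype.card_sum, Fintype.card_prod, Fintype.card_fin]
    ring
  let e : (σ × Fin m) ⊕ Fin m ≃ Fin ((Fintype.card σ + 1) * m) := Fintype.equivFinOfCardEq hcard
  refine ⟨fun p => Matrix.reindex e e M p.1 p.2, fun p => hent _ _, ?_⟩
  rw [detPoly, AlgHom.map_det, Matrix.mvPolynomialX_mapMatrix_aeval, Matrix.det_reindex_self, hM]


/-- **`pdc f ≤ (#σ + 1) · dc f`**: Valiant's projection determinantal complexity is at most the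
affine determinantal complexity times the number of variables plus one — the attained affine
representation (`hasDetRepr_determinantalComplexity_holds`) expands to a projection of the
determinant (`stub_isDetProjection_of_hasDetRepr`), and `pdc` is an infimum (`Nat.sInf_le`).
Bürgisser 2000, §2.5; arXiv:2406.06217, Def. 2.35 / Prop. 2.23. -/
theorem detProjectionComplexity_le_mul_determinantalComplexity {k : Type} [CommRing k]
    {σ : Type} [Fintype σ] (f : MvPolynomial σ k) :
    detProjectionComplexity f ≤ (Fintype.card σ + 1) * determinantalComplexity f :=
  Nat.sInf_le (stub_isDetProjection_of_hasDetRepr f _ (hasDetRepr_determinantalComplexity_holds f))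

/-- **`VP ⇒ pdc` quasi-polynomially bounded** (generic form of the crux; Bürgisser–Clausen–
Shokrollahi 1997, Cor. (21.40); Bürgisser 2000, Prop. 2.30 / §2.5): for a `VP` family `f` over a
field, `n ↦ pdc(f_n)` is quasi-polynomially bounded — `pdc(f_n) ≤ (#σ_n + 1) · dc(f_n)`, the first
factor is p-bounded (`f` is a p-family) hence qp-bounded, the second is qp-bounded
(`isQPBounded_determinantalComplexity_of_isVPFamily_holds`), and qp-bounded functions are closed
under products (`stub_isQPBounded_mul`). -/
theorem isQPBounded_detProjectionComplexity_of_isVPFamily {k : Type} [Field k] {σ : ℕ → Type}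
    [∀ n, Fintype (σ n)] (f : ∀ n, MvPolynomial (σ n) k) (hf : IsVPFamily f) :
    IsQPBounded (fun n => detProjectionComplexity (f n)) := by
  have hdc : IsQPBounded (fun n => determinantalComplexity (f n)) :=
    isQPBounded_determinantalComplexity_of_isVPFamily_holds f hf
  have hvar : IsQPBounded (fun n => Fintype.card (σ n) + 1) := by
    obtain ⟨c, hc⟩ := hf.1.1
    refine IsPBounded.isQPBounded ⟨c + 2, fun n => ?_⟩
    have h : Fintype.card (σ n) ≤ n ^ c + c := hc n
    have hp : n ^ c ≤ n ^ (c + 2) + 1 := by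
      rcases Nat.eq_zero_or_pos n with rfl | hn
      · rcases Nat.eq_zero_or_pos c with rfl | hc0
        · simp
        · rw [zero_pow hc0.ne']
          exact Nat.zero_le _
      · exact (Nat.pow_le_pow_right hn (by omega)).trans (Nat.le_succ _)
    show Fintype.card (σ n) + 1 ≤ n ^ (c + 2) + (c + 2)
    omega
  obtain ⟨c, hc⟩ := stub_isQPBounded_mul _ _ hvar hdc
  exact ⟨c, fun n => (detProjectionComplexity_le_mul_determinantalComplexity (f n)).trans (hc n)⟩

/-- THE CRUX, `ProjectionRigidity` copy (stmt-ValiantsHypothesis-16003): if the permanent family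
is a `VP` family then `n ↦ pdc(per_n)` is quasi-polynomially bounded
(`isQPBounded_detProjectionComplexity_of_isVPFamily` at `f_n = per_n`). -/
theorem pdcQpOfVp_proof' :
    Summit.ValiantsHypothesis.ValiantsHypothesis.Theses.ProjectionRigidity.PdcQpOfVp := by
  unfold Summit.ValiantsHypothesis.ValiantsHypothesis.Theses.ProjectionRigidity.PdcQpOfVp
  exact isQPBounded_detProjectionComplexity_of_isVPFamily (fun n => perPoly (Fin n) ℂ)

/-- THE CRUX, `ProjectionStability` copy (stmt-ValiantsHypothesis-16003, shared item; the two
route copies are the same statement): if the permanent family is a `VP` family then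
`n ↦ pdc(per_n)` is quasi-polynomially bounded. -/
theorem pdcQpOfVp_proof :
    Summit.ValiantsHypothesis.ValiantsHypothesis.Theses.ProjectionStability.PdcQpOfVp := by
  unfold Summit.ValiantsHypothesis.ValiantsHypothesis.Theses.ProjectionStability.PdcQpOfVp
  exact isQPBounded_detProjectionComplexity_of_isVPFamily (fun n => perPoly (Fin n) ℂ)

end Summit.ValiantsHypothesis.ValiantsHypothesis.Theorems.ProjectionStabilityPdcQpOfVp
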